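import Summits.QuantumFields.YangMills.Theorems.UnitScaleTiltProp7PinnedSkewSplit
import HarnessLib

/-!
# Route `UnitScaleTilt`, crux K1 «MinimiserStabilityRegPr» (stmt-QuantumFields-19200), line «route-R» — GROWTH row N8 (W-SEAT MAP #3 M8), file F5:
# THE SKEW∕HERMITIAN READING AT THE PINNED OPTIMUM — the hypothesis «off-centre divergence Hermitian» of F4 (✓ p607594) DISCHARGED from the point-Landau
# slice equation (✓ p605285), and the flat nonlinear-representative form of P-lin with NO divergence term

Cell `ym3-torus`, D-0154 (3c) twin-width seat `ym-routeR-w1` (gen 0); `--supports stmt-QuantumFields-19200 --as helper`; THEOREMS ONLY (0 `def`, 0 `sorry`).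
YM₃ on T³ is a ladder rung (R3), not the Clay problem; nothing here claims the stub, the crux, d = 4 or the mass gap.

WHAT IS PROVED (sorry-free, no definition):
* §1 ★ `conjTranspose_divB_optimalRepr` — for EVERY background `U₀` and the `ℓ²`-optimal pinned representative `W` (p605285's `hopt`), at every finest site
  `x` off the `(K−n)`-centres the backward covariant divergence of `Y = WU₀^* − 1` is HERMITIAN: `(D^*_{U₀}Y)(x)ᴴ = (D^*_{U₀}Y)(x)` (p605285's right-hand side
  is a difference of `MᴴM`'s and of their unitary conjugates).  Covariant letter — reusable by the curved fork.
* §2 `divB_one_eq_diverg` — the flat bridge between p483802's letters and `LatticeFieldCalculus`: at `U₀ ≡ 1`,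
  `divB (torusT) (unitsField (toUField 1)) A x = diverg 1 (fun b => A b.dir b.src) x`.
* §3 ★★ `sum_normSq_le_of_pinnedOpt_flat_T3` — F4's `sum_normSq_le_of_hermDiv_of_polar_T3` with `hherm` discharged at the flat background: for `W` pinned-optimal
  relative to `U₀ ≡ 1`, `Y(b) = W(b) − 1`, `‖Y(b)‖ ≤ s`, and ANY composite `Q^{(K−n)}` of `linAvg`:
  `(1 − s²∕2)·Σ_b |Y(b)|²_F ≤ (8400·2²·L⁴∕(√L − 1)² + 97∕8)·(L^{K−n})²·Σ_p |(∂Y)(p)|²_F + 28·L^{K−n}·Σ_c |(Q^{(K−n)}Y)(c)|²_F` —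
  k-UNIFORM, no divergence source, no `(L^k)^3`; what stays displayed toward route-R's (ii′) is exactly M10(b) (the `Q`-defect) and M10(c) (`∂Y ↔ R_p − 1`, ✓ p605008).

HONEST SCOPE.  §3 is the flat-background statement; nothing of Bałaban's analysis is asserted.

References: T. Bałaban, CMP 99 (1985) 75–102 [Balaban1985RegularSpaces] ((1.38) p.82); CMP 99 (1985) 389–434 [Balaban1985BackgroundPropagators] ((3.8) p.392);
CMP 102 (1985) 277–309 [Balaban1985Variational] ((4) p.278, Prop. 7 p.299); CMP 95 (1984) 17–40 [Balaban1984PropagatorsI] (Prop. 1.1 (1.90) p.33).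
-/

set_option autoImplicit false

noncomputable section

open scoped BigOperators Matrix.Norms.L2Operator Matrix

namespace Summit.QuantumFields.YangMills.Theorems.Prop7PinnedSkewSplitOpt

open Literature.MathematicalPhysics.QuantumFieldTheory.Balaban1983to89
open Literature.MathematicalPhysics.QuantumFieldTheory.Balaban1983to89.T3ContinuumYM3Torus
open Literature.MathematicalPhysics.QuantumFieldTheory.Balaban1983to89.T3PrintedRegularOrbits (descTransf)
open Finset B1RG242Torus BlockAveragingEMLLinearised LatticeFieldCalculus
open T4Continuum B15DeterminingSets
open B9Eq39Adjoint (divB)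
open B10Eq27TorusAxialLog (unitsField toUField)
open B9TorusCalculus (torusT)
open BlockAveragingEMLLinearisedBackground (pertVar)
open Summit.QuantumFields.YangMills.Theorems.Prop7PointLandauDivergence (divB_apply divB_optimalRepr_eq)
open Summit.QuantumFields.YangMills.Theorems.Prop7PinnedSkewSplit (sum_normSq_le_of_hermDiv_of_polar)

section Lattice

variable (F : T3Family) {n K : ℕ} (h : n ≤ K)

/-! ## §1 The off-centre covariant divergence of the pinned optimum is Hermitian (every background) -/

/-- ★ **HERMITIAN OFF THE CENTRES** (every background `U₀`): for the `ℓ²`-optimal pinned representative `W` and every finest site `x` off the `(K−n)`-centres,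
`(D^*_{U₀}Y)(x)ᴴ = (D^*_{U₀}Y)(x)`, `Y = WU₀^* − 1` — the right-hand side of p605285's slice identity is `½(Σ_μ Y_bᴴY_b − Σ_μ U₀^*·Y_bᴴY_b·U₀)`, a difference
of Hermitian matrices. [cite: Balaban1985RegularSpaces, (1.38) p.82; Balaban1985BackgroundPropagators, (3.8) p.392] -/
theorem conjTranspose_divB_optimalRepr (U₀ W : GaugeField (F.P K) 0 (Matrix.specialUnitaryGroup (Fin 2) ℂ))
    (hopt : ∀ v : GaugeTransf (F.P K) 0 (Matrix.specialUnitaryGroup (Fin 2) ℂ), descTransf F n K h v = (fun _ => 1) →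
      ∑ b : PBond (F.P K) 0, ‖pertVar U₀ W b‖ ^ 2 ≤ ∑ b : PBond (F.P K) 0, ‖pertVar U₀ (GaugeField.gaugeAct v W) b‖ ^ 2)
    {x : Site (F.P K) 0} (hx : ∀ y : Site (F.P K) (K - n), embIter (K - n) y ≠ x) :
    (divB (torusT (F.P K) 0) (fun κ z => unitsField (toUField U₀) ⟨z, κ⟩)
        (fun κ z => (W ⟨z, κ⟩ : Matrix (Fin 2) (Fin 2) ℂ) * star (U₀ ⟨z, κ⟩ : Matrix (Fin 2) (Fin 2) ℂ) - 1) x)ᴴ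
      = divB (torusT (F.P K) 0) (fun κ z => unitsField (toUField U₀) ⟨z, κ⟩)
        (fun κ z => (W ⟨z, κ⟩ : Matrix (Fin 2) (Fin 2) ℂ) * star (U₀ ⟨z, κ⟩ : Matrix (Fin 2) (Fin 2) ℂ) - 1) x := by
  rw [divB_optimalRepr_eq F h U₀ W hopt hx]
  have h2 : star ((2 : ℂ)⁻¹) = (2 : ℂ)⁻¹ := by rw [star_inv₀]; norm_num
  rw [Matrix.conjTranspose_smul, h2, Matrix.conjTranspose_sub, Matrix.conjTranspose_sum, Matrix.conjTranspose_sum]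
  congr 1
  congr 1
  · refine Finset.sum_congr rfl fun μ _ => ?_
    rw [Matrix.conjTranspose_mul, Matrix.conjTranspose_conjTranspose]
  · refine Finset.sum_congr rfl fun μ _ => ?_
    simp only [Matrix.star_eq_conjTranspose, Matrix.conjTranspose_mul, Matrix.conjTranspose_conjTranspose, Matrix.mul_assoc]

/-! ## §2 The flat bridge: `D^*_{1} = ∂^*` between p483802's letters and `LatticeFieldCalculus` -/

/-- **AT THE FLAT BACKGROUND THE BACKWARD COVARIANT DIVERGENCE IS THE LATTICE DIVERGENCE**:
`divB (torusT) (unitsField (toUField 1)) A x = Σ_μ (A_μ(x − e_μ) − A_μ(x)) = diverg 1 (fun b => A b.dir b.src) x`. [cite: Balaban1985BackgroundPropagators, (3.8) p.392] -/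
theorem divB_one_eq_diverg (A : Fin (F.P K).d → Site (F.P K) 0 → Matrix (Fin 2) (Fin 2) ℂ) (x : Site (F.P K) 0) :
    divB (torusT (F.P K) 0) (fun κ z => unitsField (toUField (fun _ : PBond (F.P K) 0 => (1 : Matrix.specialUnitaryGroup (Fin 2) ℂ))) ⟨z, κ⟩) A x
      = diverg 1 (fun b : PBond (F.P K) 0 => A b.dir b.src) x := by
  rw [divB_apply F (fun _ : PBond (F.P K) 0 => (1 : Matrix.specialUnitaryGroup (Fin 2) ℂ)) A x]
  simp only [diverg, one_smul, OneMemClass.coe_one, star_one, Matrix.one_mul, Matrix.mul_one]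

/-! ## §3 The flat nonlinear-representative reading of P-lin: F4 with `hherm` discharged -/

/-- ★★ **P-LIN AT THE PINNED OPTIMUM, FLAT BACKGROUND — NO DIVERGENCE TERM** (`d = 3`, run `K`, comparison height `n ≤ K`, `k = K − n`): let `W` be `ℓ²`-optimal on
its pinned (4)-orbit relative to the flat background `U₀ ≡ 1`, `Y(b) = W(b) − 1`, `‖Y(b)‖ ≤ s`, and let `Q^{(k)}` be any composite of the linearised average
(`hQ0`, `hQs`).  Then `(1 − s²∕2)·Σ_b |Y(b)|²_F ≤ (8400·2²·L⁴∕(√L − 1)² + 97∕8)·(L^k)²·Σ_p |(∂Y)(p)|²_F + 28·L^k·Σ_c |(Q^{(k)}Y)(c)|²_F` — the point-Landau divergence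
of the optimum is Hermitian off the centres (§1 at `U₀ ≡ 1`, §2), so F4 applies with `N = 2`; k-uniform, no `(L^k)^3`.
[cite: Balaban1985RegularSpaces, (1.38) p.82; Balaban1985Variational, Prop. 7 p.299, (4) p.278; Balaban1984PropagatorsI, Prop. 1.1 (1.90) p.33] -/
theorem sum_normSq_le_of_pinnedOpt_flat_T3 (W : GaugeField (F.P K) 0 (Matrix.specialUnitaryGroup (Fin 2) ℂ))
    (hopt : ∀ v : GaugeTransf (F.P K) 0 (Matrix.specialUnitaryGroup (Fin 2) ℂ), descTransf F n K h v = (fun _ => 1) →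
      ∑ b : PBond (F.P K) 0, ‖pertVar (fun _ => 1) W b‖ ^ 2 ≤ ∑ b : PBond (F.P K) 0, ‖pertVar (fun _ => 1) (GaugeField.gaugeAct v W) b‖ ^ 2)
    (Q : (i : ℕ) → (PBond (F.P K) 0 → Matrix (Fin 2) (Fin 2) ℂ) → PBond (F.P K) i → Matrix (Fin 2) (Fin 2) ℂ)
    (hQ0 : ∀ Y, Q 0 Y = Y)
    (hQs : ∀ (i : ℕ) (Y : PBond (F.P K) 0 → Matrix (Fin 2) (Fin 2) ℂ) (c : PBond (F.P K) (i + 1)), Q (i + 1) Y c = linAvg (Q i Y) c)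
    (Y : PBond (F.P K) 0 → Matrix (Fin 2) (Fin 2) ℂ) (hY : ∀ b, Y b = (W b : Matrix (Fin 2) (Fin 2) ℂ) - 1)
    {s : ℝ} (hs : ∀ b, ‖Y b‖ ≤ s) :
    (1 - s ^ 2 / 2) * ∑ b : PBond (F.P K) 0, ∑ a : Fin 2, ∑ b' : Fin 2, Complex.normSq ((Y b) a b')
      ≤ (8400 * (2 : ℝ) ^ 2 * (F.L : ℝ) ^ 4 / (Real.sqrt F.L - 1) ^ 2 + 97 / 8) * ((F.L : ℝ) ^ (K - n)) ^ 2
          * ∑ p : Plaq (F.P K) 0, ∑ a : Fin 2, ∑ b' : Fin 2, Complex.normSq ((curl 1 Y p) a b')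
        + 28 * (F.L : ℝ) ^ (K - n) * ∑ c : PBond (F.P K) (K - n), ∑ a : Fin 2, ∑ b' : Fin 2, Complex.normSq ((Q (K - n) Y c) a b') := by
  -- the field in p483802's letters at `U₀ ≡ 1`
  set U₀ : GaugeField (F.P K) 0 (Matrix.specialUnitaryGroup (Fin 2) ℂ) := fun _ => 1 with hU₀
  have hA : (fun b : PBond (F.P K) 0 => (fun κ z => (W ⟨z, κ⟩ : Matrix (Fin 2) (Fin 2) ℂ) * star (U₀ ⟨z, κ⟩ : Matrix (Fin 2) (Fin 2) ℂ) - 1) b.dir b.src) = Y := by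
    funext b
    rw [hY b, hU₀]
    simp only [OneMemClass.coe_one, star_one, Matrix.mul_one]
  -- `hherm` from §1 and §2
  have hherm : ∀ x : Site (F.P K) 0, x ∉ Set.range (embIter (K - n)) → (diverg 1 Y x)ᴴ = diverg 1 Y x := by
    intro x hx
    have hx' : ∀ y : Site (F.P K) (K - n), embIter (K - n) y ≠ x := fun y hy => hx ⟨y, hy⟩
    have hH := conjTranspose_divB_optimalRepr F h U₀ W hopt hx'
    rw [hU₀, divB_one_eq_diverg F, ← hU₀, hA] at hH
    exact hH
  have hV : ∀ b : PBond (F.P K) 0, (W b : Matrix (Fin 2) (Fin 2) ℂ) ∈ Matrix.unitaryGroup (Fin 2) ℂ := fun b => (W b).2.1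
  have hmain := Prop7PinnedSkewSplit.sum_normSq_le_of_hermDiv_of_polar_T3 F K n Q hQ0 hQs (fun b => (W b : Matrix (Fin 2) (Fin 2) ℂ)) Y hV hY hs hherm
  have h2 : (1 - ((2 : ℕ) : ℝ) * s ^ 2 / 4) = 1 - s ^ 2 / 2 := by push_cast; ring
  have h2' : ((2 : ℕ) : ℝ) ^ 2 = (2 : ℝ) ^ 2 := by push_cast; ring
  rw [h2, h2'] at hmain
  exact hmain

end Lattice

end Summit.QuantumFields.YangMills.Theorems.Prop7PinnedSkewSplitOpt

end
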